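import Literature.AlgebraicGeometry.Motives.JacobianPrimeThetaDivisorExists
import Literature.AlgebraicGeometry.Motives.JacobianThetaKThetaTrivialOfMultOne
import Literature.AlgebraicGeometry.Motives.CartierDivisorReducedMultiplicityOne
import Literature.AlgebraicGeometry.Motives.AbelianVarietyTwoSmulSectionsCover
import Literature.AlgebraicGeometry.Motives.AbelianVarietyFiniteOfFibreTranslate
import Literature.AlgebraicGeometry.Motives.AbelianVarietyTranslationLemma
import Literature.AlgebraicGeometry.Motives.AbelianVarietyKThetaOfTranslationSupport
import Literature.AlgebraicGeometry.Motives.JacobianBrillNoetherLocusIrreducible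
import Literature.AlgebraicGeometry.Motives.AbelTheorem
import Literature.AlgebraicGeometry.Motives.VarietiesGeometricallyIntegralProofs
import Literature.AlgebraicGeometry.Motives.VarietiesProperProofs
import HarnessLib

/-!
# RIEMANN'S THEOREM ON THE THETA DIVISOR — the named fact `Jacobian.riemann_brillNoetherLocus_isPrincipalPolarizationDivisor`
# (interface row VI-7) PROVED: `W̃_{g−1}` is a principal polarisation divisor of the Jacobian of a smooth projective complex curve

Layer `Literature/AlgebraicGeometry/Motives`, namespace `Literature.AlgebraicGeometry.Motives.Jacobian`.  ONE THEOREM; no definition, no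
named fact, no instance, no `sorry`.  Cell `hodgecm-mathlib` (D-0151), road G5 (pen A-p04 (g18); director ruling s233): the Prop-valued
named fact `riemann_brillNoetherLocus_isPrincipalPolarizationDivisor` of `Motives/JacobianThetaDivisor` — for every smooth projective complex
curve `C` and every Jacobian `𝒥` of `C` with `dim J ≥ 1` there is a Cartier divisor `Θ` on `J` which is a Riemann theta divisor
(effective, support a translate of `W̃_{g−1}(P)`) AND a principal polarisation divisor (ample with `K(Θ)(ℂ) = ⊥`) — [Lange2023AbelianVarietiesComplex]
§4.2.1 Lemma 4.2.1 (iii) / Cor. 4.2.4, [Milne1986JacobianVarieties] §6 Thm. 6.6 — is INHABITED, by the witness `Θ_W = [W̃_{g−1}(c)]`, the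
PRIME THETA DIVISOR, and the G5 road, all of whose leaves are theorems of the tree:

* (V7-a) ★ `Jacobian.exists_isRiemannThetaDivisor_support_eq_isIntegral` (`Motives/JacobianPrimeThetaDivisorExists`): `dim W̃_{g−1}(c) = g − 1`
  unconditionally, so the prime divisor `Θ_W` of the irreducible codimension-one closed set `W̃_{g−1}(c)` on the regular `J` exists
  (Auslander–Buchsbaum ★ `isEffectiveCartier_primeDivisorIdeal_of_isRegular`), with support exactly `W̃_{g−1}(c)` and `Z(Θ_W)` integral;
  multiplicity one in the effective form follows ★ `AbelianVariety.eq_one_of_sameDivisor_smul_of_isReduced` (`Motives/CartierDivisorReducedMultiplicityOne`).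
* (V7-b) ★ `Jacobian.KTheta_eq_bot_of_isRiemannThetaDivisor_of_forall_eq_one` (`Motives/JacobianThetaKThetaTrivialOfMultOne`): `K(Θ_W)(ℂ) = ⊥`
  by Lange's Lemma 4.4.4 Step I / Milne JV Lemma 6.7 in Abel–Jacobi currency re-keyed from principality to multiplicity one (the VI-8 road's
  leaves ★ `hopen` / `hmult` / (M″) / (SYM) / transport), Cor. 4.4.5 on all of `J(ℂ)` ★ `aj_classPullback_weilDiv_eq_inv_of_translate` and
  ★ `KTheta_eq_bot_of_aj_classPullback_weilDiv_eq_inv`; Abel's theorem ★ `Jacobian.ajSum_congr_linEquiv` (`Motives/AbelTheorem`).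
* (V7-c) MUMFORD §6 APPLICATION 1 «effective `D` with `K(D)` finite ⇒ `D` ample»: ★ `AbelianVariety.isAmple_of_isEffective_of_forall_isFinite`
  (`Motives/AbelianVarietyTwoSmulSectionsCover`: `|2D|` base-point free by the theorem of the square, `φ = toProj`, one translate per fibre,
  finite `φ` ⇒ affine non-vanishing loci ⇒ ample with `d = 2`), ★ `AbelianVariety.isFinite_of_preimage_subset_translate_of_KTheta_eq_bot_of_lemmas`
  (`Motives/AbelianVarietyFiniteOfFibreTranslate`: a proper non-finite `φ` has a positive-dimensional irreducible closed `Z` in a fibre with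
  `Z(ℂ)` infinite, whose differences stabilise `Supp D`), the translation lemma ★ `AbelianVariety.image_translation_support_eq_of_subset_preimage` (`Motives/AbelianVarietyTranslationLemma`,
  Mumford p. 61) and the transfer ★ `AbelianVariety.mem_KTheta_of_image_translation_support_eq` (`Motives/AbelianVarietyKThetaOfTranslationSupport`).

With this file the interface row VI-7 is a THEOREM (books: director s233); its registered consumers (`socketRosH_GS_of_FR_FP2` ★ p765203, the
d6 tail's `rosH_holds`) take it BY NAME.  HC_CM is proved only modulo the 7 printed citations until rung 0 closes.

## References
* [Lange2023AbelianVarietiesComplex] H. Lange, *Abelian Varieties over the Complex Numbers* (2023), §4.2.1 Lemma 4.2.1 (iii) with §4.1.2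
  Prop. 4.1.2 and Cor. 4.2.4; §4.4.2 Lemma 4.4.4 and Cor. 4.4.5 (p. 224).
* [Milne1986JacobianVarieties] J. S. Milne, *Jacobian Varieties* (1986), §6 Thm. 6.6 and Lemma 6.7 (p. 187).
* [MumfordAV1970] D. Mumford, *Abelian Varieties* (1970), §6 Application 1 and its proof (pp. 60–61).
-/

set_option autoImplicit false

noncomputable section

open CategoryTheory AlgebraicGeometry

namespace Literature.AlgebraicGeometry.Motives

namespace Jacobian

/-- **Riemann's theorem on the theta divisor** — the named fact `Jacobian.riemann_brillNoetherLocus_isPrincipalPolarizationDivisor` (row VI-7)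
holds: every Jacobian `𝒥` (`dim J ≥ 1`) of a smooth projective complex curve carries a Riemann theta divisor which is a principal polarisation
divisor, namely the prime divisor `Θ_W = [W̃_{g−1}(c)]` at any base point `c`: effective with support `W̃_{g−1}(c)` ((V7-a)), `K(Θ_W)(ℂ) = ⊥`
((V7-b), Step I in Abel–Jacobi currency) and ample ((V7-c), Mumford §6 Application 1) — module docstring.
[cite: Lange2023AbelianVarietiesComplex, §4.2.1 Lemma 4.2.1 (iii) with §4.1.2 Prop. 4.1.2 and Cor. 4.2.4]
[cite: Milne1986JacobianVarieties, §6 Thm. 6.6] [cite: MumfordAV1970, §6 Application 1 and its proof (pp. 60–61)] -/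
theorem riemann_brillNoetherLocus_isPrincipalPolarizationDivisor_holds : riemann_brillNoetherLocus_isPrincipalPolarizationDivisor := by
  intro C hC 𝒥 hdim
  haveI : IsIntegral C.left := IsSmoothProjective.isIntegral_holds hC
  haveI := hC.smoothOfRelativeDimension
  haveI : IsProper C.hom := IsSmoothProjective.isProper_holds hC
  haveI : IsLocallyNoetherian C.left := inferInstance
  obtain ⟨c⟩ := hC.nonempty_algPoints ℂ
  -- (V7-a): the prime theta divisor at the base point `c`, with `Z(Θ)` integral
  obtain ⟨Θ, h0, h1, hsupp, hZ⟩ := 𝒥.exists_isRiemannThetaDivisor_support_eq_isIntegral hC hdim c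
  have hirr : IsIrreducible (Θ.nonvanishing 1)ᶜ := hsupp ▸ isIrreducible_brillNoetherLocus_of_isSmoothProjective hC 𝒥 c _
  haveI : IsIntegral h0.idealSheaf.subscheme := hZ
  -- multiplicity one (weak∕effective form) from reducedness
  have hone : ∀ (E : CartierDivisor 𝒥.J.X.left) (m : ℕ), E.IsEffective → 0 < m → Θ.SameDivisor (m • E) → m = 1 :=
    fun E m hE hm h => AbelianVariety.eq_one_of_sameDivisor_smul_of_isReduced 𝒥.J h0 hirr hE hm h
  -- ABEL
  have hA : ∀ {E F : CartierDivisor C.left}, E.LinEquiv F → 𝒥.ajSum c E = 𝒥.ajSum c F :=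
    fun h => 𝒥.ajSum_congr_linEquiv c h
  -- (V7-b): `K(Θ)(ℂ) = ⊥`
  have hK : 𝒥.J.KTheta Θ = ⊥ := KTheta_eq_bot_of_isRiemannThetaDivisor_of_forall_eq_one hC 𝒥 c hA h1 hone
  -- (V7-c): Mumford §6 Application 1 ⇒ `Θ` ample
  have hamp : Θ.IsAmple :=
    AbelianVariety.isAmple_of_isEffective_of_forall_isFinite 𝒥.J h0 fun P φ hφ hJ hcov => by
      haveI := hφ
      haveI := hJ
      exact AbelianVariety.isFinite_of_preimage_subset_translate_of_KTheta_eq_bot_of_lemmas 𝒥.J Θ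
        (fun Z hZc hZi y hy z z' hz hz' =>
          AbelianVariety.image_translation_support_eq_of_subset_preimage 𝒥.J h0 hirr hZc hZi y hy hz hz')
        (fun x hx => AbelianVariety.mem_KTheta_of_image_translation_support_eq 𝒥.J h0 hirr hone hx) hK φ hcov
  exact ⟨Θ, h1, hamp, hK⟩

end Jacobian

end Literature.AlgebraicGeometry.Motives

end
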